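import Summits.QuantumAdvantage.QuantumAdvantage.Theses.MobiusLadder
import Summits.QuantumAdvantage.QuantumAdvantage.Theorems.MobiusLadderLiouvilleNotTC0

/-!
# Liouville twins: the kernel and the composition of line `Sketch` for the crux
`MobiusLadder.LiouvilleNotPPoly` (stmt-QuantumAdvantage-1389)

Helper file (continuation lead c2, line `Sketch`, idea `twin-exclusion-rigidity`). An integer `d`
is a *Liouville twin of level `x`* when `(d | p) = −1` for every odd prime `p ≤ x`. Proved here:

* `jacobiSym_eq_liouville_of_twin` — twins compute `λ`: `(d | N) = λ(N)` for all odd `N ≤ x`;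
* `not_dvd_of_twin` — twins are `x`-rough at odd primes;
* `liouvilleNotPPoly_of_charRigidity_twinFreeDensity` — THE COMPOSITION of the line, by name:
  character rigidity with growing conductor (CR: an easy completely multiplicative `±1` function
  is, at every large scale, a polynomial-bit Jacobi symbol off an eighth of the primes) and
  twin-freeness in density (TF: polynomial-bit `d` are non-inert at three eighths of the primes
  below `2^n`) imply the crux, by counting (`λ(p) = −1` at every prime).

Theorems only; both hypotheses of the composition are stated inline over tree vocabulary.
-/

set_option linter.dupNamespace false -- D-0017: single-problem summit ⇒ `QuantumAdvantage.QuantumAdvantage` by design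

namespace Summit.QuantumAdvantage.QuantumAdvantage.Theorems.LiouvilleNotPPoly

open _root_.Computability Literature.Computability.Complexity Filter Finset

/-- `λ(p) = −1` at a prime. -/
theorem liouville_prime {p : ℕ} (hp : p.Prime) : ArithmeticFunction.liouville p = -1 := by
  rw [ArithmeticFunction.liouville_apply hp.ne_zero, ArithmeticFunction.cardFactors_apply_prime hp,
    pow_one]

/-- **Twins compute `λ`**: if `(d | p) = −1` for every odd prime `p ≤ x`, then `(d | N) = λ(N)`
for every odd `N ≤ x`, `N ≠ 0` (complete multiplicativity of the Jacobi symbol in its bottom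
argument; every prime factor of an odd `N ≤ x` is an odd prime `≤ x`). -/
theorem jacobiSym_eq_liouville_of_twin {d : ℤ} {x : ℕ}
    (h : ∀ p : ℕ, p.Prime → p ≠ 2 → p ≤ x → jacobiSym d p = -1) :
    ∀ N : ℕ, N ≠ 0 → Odd N → N ≤ x → jacobiSym d N = ArithmeticFunction.liouville N := by
  intro N
  induction N using Nat.strong_induction_on with
  | _ N ih =>
    intro hN hodd hle
    rcases Nat.lt_or_ge N 2 with h2 | h2
    · obtain rfl : N = 1 := by omega
      rw [jacobiSym.one_right]
      exact ArithmeticFunction.liouville_apply_one.symm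
    · have hp : N.minFac.Prime := Nat.minFac_prime (by omega)
      obtain ⟨m, hm⟩ := Nat.minFac_dvd N
      have hm0 : m ≠ 0 := by
        rintro rfl
        rw [mul_zero] at hm
        exact hN hm
      have hoddpm : Odd (N.minFac * m) := hm ▸ hodd
      have hp2 : N.minFac ≠ 2 := by
        intro h2'
        have : Even (N.minFac * m) := ⟨m, by rw [h2']; ring⟩
        exact (Nat.not_even_iff_odd.2 hoddpm) this
      have hmodd : Odd m := (Nat.odd_mul.1 hoddpm).2
      have hmle : m ≤ N := by
        calc m = 1 * m := (one_mul m).symm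
          _ ≤ N.minFac * m := Nat.mul_le_mul_right m hp.one_lt.le
          _ = N := hm.symm
      have hmlt : m < N := by
        have : 1 * m < N.minFac * m := Nat.mul_lt_mul_of_pos_right hp.one_lt (Nat.pos_of_ne_zero hm0)
        rw [one_mul] at this
        omega
      have hpx : N.minFac ≤ x := (Nat.minFac_le (by omega)).trans hle
      conv_lhs => rw [hm]
      conv_rhs => rw [hm]
      rw [jacobiSym.mul_right' d hp.ne_zero hm0, ArithmeticFunction.liouville_apply_mul,
        h _ hp hp2 hpx, liouville_prime hp, ih m hmlt hm0 hmodd (hmle.trans hle)]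

/-- **Twins are rough**: no odd prime `p ≤ x` divides a twin of level `x` (`(d | p) = 0` if
`p ∣ d`); in particular smooth-conductor characters are never twins. -/
theorem not_dvd_of_twin {d : ℤ} {x : ℕ}
    (h : ∀ p : ℕ, p.Prime → p ≠ 2 → p ≤ x → jacobiSym d p = -1) :
    ∀ p : ℕ, p.Prime → p ≠ 2 → p ≤ x → ¬ (p : ℤ) ∣ d := by
  intro p hp hp2 hpx hdvd
  have hval := h p hp hp2 hpx
  rw [jacobiSym.mod_left, Int.emod_eq_zero_of_dvd hdvd, jacobiSym.zero_left hp.one_lt] at hval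
  norm_num at hval

/-- A twin of level `≥ 3` is nonzero. -/
theorem ne_zero_of_twin {d : ℤ} {x : ℕ}
    (h : ∀ p : ℕ, p.Prime → p ≠ 2 → p ≤ x → jacobiSym d p = -1) (hx : 3 ≤ x) : d ≠ 0 := by
  rintro rfl
  have := h 3 Nat.prime_three (by norm_num) hx
  rw [jacobiSym.zero_left (by norm_num : 1 < 3)] at this
  norm_num at this

/-- For `f = λ` the disagreement set of CR is the non-inert set of TF (`λ(p) = −1`). -/
theorem filter_disagree_liouville_eq (d : ℤ) (n : ℕ) :
    ((range (2 ^ n)).filter fun p => p.Prime ∧ jacobiSym d p ≠ ArithmeticFunction.liouville p) =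
      (range (2 ^ n)).filter fun p => p.Prime ∧ jacobiSym d p ≠ -1 := by
  refine Finset.filter_congr fun p _ => ?_
  constructor
  · rintro ⟨hp, h⟩
    exact ⟨hp, by rwa [liouville_prime hp] at h⟩
  · rintro ⟨hp, h⟩
    exact ⟨hp, by rwa [liouville_prime hp]⟩

/-- `2` is a prime below `2^n` for `n ≥ 2`, so `π(2^n) ≠ 0`. -/
theorem card_filter_prime_range_two_pow_ne_zero {n : ℕ} (hn : 2 ≤ n) :
    ((range (2 ^ n)).filter Nat.Prime).card ≠ 0 := by
  rw [Finset.card_ne_zero]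
  refine ⟨2, Finset.mem_filter.2 ⟨Finset.mem_range.2 ?_, Nat.prime_two⟩⟩
  calc 2 < 4 := by norm_num
    _ = 2 ^ 2 := by norm_num
    _ ≤ 2 ^ n := Nat.pow_le_pow_right (by norm_num) hn

/-- **The composition of line `Sketch`: character rigidity with growing conductor (CR) and
twin-freeness in density (TF) imply the crux `LiouvilleNotPPoly`, BY NAME.** If `L_λ ∈ P/poly`,
CR with `f = λ` (completely multiplicative, `±1`-valued) supplies `k` and, eventually in `n`, a
`d_n` of `≤ n^k` bits agreeing with `λ` off an eighth of the primes below `2^n`, i.e. inert off an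
eighth of them; TF at budget `k` makes every such `d_n` non-inert at three eighths of them; so
`π(2^n) = 0`, contradicting `2 < 2^n` for `n ≥ 2`. -/
theorem liouvilleNotPPoly_of_charRigidity_twinFreeDensity :
    (∀ f : ℕ → ℤ, (∀ m n : ℕ, f (m * n) = f m * f n) → (∀ n : ℕ, n ≠ 0 → f n = 1 ∨ f n = -1) →
      Computability.encodingNatBool.toLanguage {N : ℕ | f N = -1} ∈
        Literature.Computability.Complexity.PPoly →
      ∃ k : ℕ, ∀ᶠ n : ℕ in Filter.atTop, ∃ d : ℤ, |d| ≤ 2 ^ n ^ k ∧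
        8 * ((Finset.range (2 ^ n)).filter fun p => p.Prime ∧ jacobiSym d p ≠ f p).card ≤
          ((Finset.range (2 ^ n)).filter Nat.Prime).card) →
    (∀ k : ℕ, ∀ᶠ n : ℕ in Filter.atTop, ∀ d : ℤ, |d| ≤ 2 ^ n ^ k →
      3 * ((Finset.range (2 ^ n)).filter Nat.Prime).card ≤
        8 * ((Finset.range (2 ^ n)).filter fun p => p.Prime ∧ jacobiSym d p ≠ -1).card) →
    Summit.QuantumAdvantage.QuantumAdvantage.Theses.MobiusLadder.LiouvilleNotPPoly := by
  intro hCR hTF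
  change encodingNatBool.toLanguage {N : ℕ | ArithmeticFunction.liouville N = -1} ∉ PPoly
  intro hmem
  obtain ⟨k, hk⟩ := hCR (fun N => ArithmeticFunction.liouville N) ArithmeticFunction.liouville_apply_mul
    (fun n hn => Summit.QuantumAdvantage.QuantumAdvantage.Theorems.MobiusLadder.liouville_eq_one_or_eq_neg_one hn) hmem
  obtain ⟨n, ⟨⟨d, hd, hCRn⟩, hTFn⟩, hn2⟩ := ((hk.and (hTF k)).and (eventually_ge_atTop 2)).exists
  have hA := hTFn d hd
  rw [filter_disagree_liouville_eq] at hCRn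
  have hπ : ((range (2 ^ n)).filter Nat.Prime).card = 0 := by omega
  exact card_filter_prime_range_two_pow_ne_zero hn2 hπ

end Summit.QuantumAdvantage.QuantumAdvantage.Theorems.LiouvilleNotPPoly
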